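import Literature.NumberTheory.EllipticCurves.MazurTateTeitelbaumWeightK
import Literature.NumberTheory.EllipticCurves.PAdicLFunction
import Mathlib.NumberTheory.Padics.Complex
import Mathlib.NumberTheory.DirichletCharacter.Basic
import HarnessLib

/-!
# The cyclotomic `p`-adic `L`-function of an ordinary newform of weight `k` (characterising predicate)

Topic `Literature/NumberTheory/EllipticCurves`, namespace
`Literature.NumberTheory.EllipticCurves.ModularForms`.

Let `g ∈ S_k(Γ₀(M))` be a newform (trivial character), `p ∤ M` a prime, `ι : K_g → ℚ̄_p` an
embedding of its coefficient field with `|ι(a_p(g))|_p = 1` (`g` is `ι`-ordinary) and `υ ∈ ℚ̄_p`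
the unit root of `X² − ι(a_p(g)) X + p^{k−1}`. The **cyclotomic `p`-adic `L`-function**
`L_p(g) = L_p(g, υ, ω⁰; T)` of Mazur–Tate–Teitelbaum (Invent. Math. 84 (1986), §I.13–I.14) is the
Mazur–Mellin transform `∫_{ℤ_p^×} (1 + T)^{ℓ(x)} dμ_{g,υ}` of the `p`-adic measure attached to the
`p`-stabilisation `g(z) − (a_p − υ) g(pz)`, normalised by a real period `Ω` of `g` (Shimura: the
imaginary parts of the period integrals `∫_r^{i∞} g(z) dz`, `r ∈ ℚ`, are `K_g`-rational multiples
of `Ω`); it is characterised by the interpolation property (MTT §I.14, (14.3) at `s = 1`, trivial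
tame character):

* `L_p(g)(0) = (1 − υ⁻¹)(1 − p^{k−2} υ⁻¹) · [0]_g`, and
* for every primitive Dirichlet character `χ` of conductor `p^m`, `m ≥ 1`, which is a character of
  `Γ = Gal(ℚ_∞/ℚ)` (even, of `p`-power order):
  `L_p(g)(χ(γ) − 1) = υ^{−m} · ∑_{a mod p^m} χ(a) [a/p^m]_g`,

where `[r]_g = Im(∫_r^{i∞} g(z) dz)/Ω ∈ K_g` (so that `∑_a χ(a)[a/p^m]_g · Ω = τ(χ) Λ(g ⊗ χ̄, 1)`
for even `χ`, Birch–Manin; `[0]_g · Ω = Λ(g, 1) = ∫₀^∞ g(it) dt`), `γ = 1 + p` (`1 + 4` for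
`p = 2`; the tree's `cyclotomicGenerator`). This is word for word the tree's weight-`2` predicate
`Literature.NumberTheory.EllipticCurves.IsPAdicLFunctionOf f p α L` (`[·]⁺_f = ratPlusSymbol f`,
`α ↔ υ`) with the two changes forced by higher weight: the Euler-type factor `(1 − p^{k−2}υ⁻¹)`
in the constant term (`(1 − pʲ/u)(1 − p^{k−2−j}/u)` at `j = 0`, as in the tree's
`exists_mtt_powerSeries_weightK`), and COEFFICIENTS IN `ℚ̄_p` (`PadicAlgCl p`) — the symbols
`[r]_g` lie in the number field `K_g`, which need not embed in `ℚ_p` at the prime of `ι`; the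
values of `L_p(g)` then lie in the finite extension `ℚ_p(ι K_g, υ)`. (The tree's
`exists_mtt_powerSeries_weightK`, file `MazurTateTeitelbaumWeightK`, CONSTRUCTS the measure and its
transform when `ι` lands in `ℚ_p` and proves the interpolation at the characters `x ↦ ⟨x⟩ʲ`; its
`j = 0` case is the first clause here, since `Im(∫_0^{i∞} g dz) = Im(i Λ(g,1)) = Λ(g,1)` by
`rayMoment_zero`.)

This file provides (GL₂ vocabulary item (V-an) of the BSD residual cell,
run/shared/lean/b2b/bsd-rank1-residual/b2b-bsdres-x11a/GL2-VOCAB-SPEC.md):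

* `PeriodSymbolDatum g` — a period `Ω ≠ 0` with `K_g`-valued symbols `σ : ℚ → K_g`,
  `Im ∫_r^{i∞} g(z) dz = σ(r)·Ω` for every `r` with denominator prime to the level (Shimura 1977,
  Thm. 1 / Manin 1973); PROVED to exist for newforms of even weight `≥ 4`
  (`IsNewform0.nonempty_periodSymbolDatum`, from the tree's Shimura theorem
  `IsNewform0.exists_re_im_mem_span_cuspidalLatticeK` and Manin's bounded denominators
  `IsNewform0.exists_fg_rayMoment_rat_mem`);
* `twistedSymbolSumK D ι χ = ∑_{a mod m} χ(a) ι(σ(a/m))` (MTT §I.8);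
* `IsCycPAdicLFunctionWeightK g D p ι υ L` — THE PREDICATE above on `L : ℚ̄_p⟦T⟧`;
* the named fact `exists_isCycPAdicLFunctionWeightK` (MTT 1986 §I.11, §I.14; Višik 1976;
  Amice–Vélu 1975): for `ι`-ordinary `g` such an `L` exists, bounded, with coefficients in a finite
  extension of `ℚ_p` — `def … : Prop`, nothing asserted (the tree proves the `ℚ_p`-rational case at
  the characters `⟨x⟩ʲ` only).

What it is for. The `λ`-invariant `normLam L`
(`Literature/NumberTheory/EllipticCurves/IwasawaLambdaNorm.lean`) of such an `L` is `λ^an(g)` of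
Emerton–Pollack–Weston, Invent. Math. 163 (2006), §3 (independent of `Ω` and of the choice of `L`,
which change `L` by a non-zero constant), the quantity in their Thm. 2 and in X. Wan, Forum Math.
Sigma 3 (2015), Thm. 4 ("`char(Sel) = (L_f)` in `Λ_{𝒪_L} ⊗ ℚ_p`") at a good-ordinary higher-weight
member of the Hida family of an elliptic curve with multiplicative reduction (the cell's X11a
chain; literature audit run/shared/lean/b2b/bsd-rank1-residual/b2b-bsdres-lit/g14/X11A-AUDIT.md).
Nothing about Selmer groups is said here.

References: B. Mazur, J. Tate, J. Teitelbaum, *On `p`-adic analogues of the conjectures of Birch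
and Swinnerton-Dyer*, Invent. Math. 84 (1986), §I.8 (8.6), §I.10–I.14, (14.3); M. M. Višik,
*Non-archimedean measures connected with Dirichlet series*, Mat. Sb. 99 (1976); Y. Amice, J. Vélu,
*Distributions `p`-adiques associées aux séries de Hecke*, Astérisque 24–25 (1975); G. Shimura, *On
the periods of modular forms*, Math. Ann. 229 (1977), Thm. 1; Ju. I. Manin, *Periods of parabolic
forms and `p`-adic Hecke series*, Mat. Sb. 92 (1973), Thm. 1.3; M. Emerton, R. Pollack, T. Weston,
Invent. Math. 163 (2006), §3.
-/

noncomputable section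

open scoped MatrixGroups ModularForm
open CongruenceSubgroup Complex
open UpperHalfPlane hiding I

namespace Literature.NumberTheory.EllipticCurves.ModularForms

/-! ### Period–symbol data (Shimura rationality at `j = 0`) -/

section Datum

variable {M : ℕ} {k : ℤ}

/-- **A period–symbol datum for a cusp form `g` on `Γ₀(M)`** (Shimura 1977, Thm. 1; Manin 1973,
Thm. 1.3): a real number `Ω ≠ 0` and symbols `σ : ℚ → K_g` with values in the coefficient field
such that `Im ∫_r^{i∞} g(z) dz = σ(r) · Ω` for every rational cusp `r` whose denominator is prime
to the level `M` (the cusps `a/p^m` for `p ∤ M`). For a newform of even weight `≥ 4` such data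
exist (`IsNewform0.nonempty_periodSymbolDatum`); `Ω` is determined up to `K_g^×` and `σ` on the
admissible cusps by `Ω`. The values of `σ` at other rationals are unconstrained (junk).
[cite: Shimura1977, Thm. 1] -/
structure PeriodSymbolDatum (g : CuspForm (Gamma0 M) k) where
  /-- the period `Ω ∈ ℝ` -/
  Ω : ℝ
  /-- `Ω ≠ 0` -/
  Ω_ne_zero : Ω ≠ 0
  /-- the `K_g`-valued modular symbol `r ↦ [r]_g = Im(∫_r^{i∞} g dz)/Ω` -/
  σ : ℚ → coeffField g
  /-- `Im ∫_r^{i∞} g(z) dz = σ(r) · Ω` for `den(r)` prime to `M` -/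
  im_rayMoment_eq : ∀ r : ℚ, IsCoprime (r.den : ℤ) (M : ℤ) →
    ((((rayMoment ⇑g 0 (r : ℝ)).im : ℝ)) : ℂ) = (σ r : ℂ) * Ω

end Datum

/-! ### Existence for newforms of even weight `≥ 4` (Shimura) -/

section Existence

variable {M : ℕ} [NeZero M] {n : ℕ}

/-- **Shimura rationality supplies a period–symbol datum**: for a newform `g` of even weight
`n + 2 ≥ 4` on `Γ₀(M)` there are `Ω ≠ 0` and `σ : ℚ → K_g` with `Im ∫_r^{i∞} g dz = σ(r)Ω` for all
`r` with denominator prime to `M` (the tree's `IsNewform0.exists_re_im_mem_span_cuspidalLatticeK`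
— Shimura 1977 Thm. 1 — and `IsNewform0.exists_fg_rayMoment_rat_mem` — Manin's bounded
denominators). [cite: Shimura1977, Thm. 1] -/
theorem IsNewform0.nonempty_periodSymbolDatum (hn : Even n) (hn0 : n ≠ 0)
    {g : CuspForm (Gamma0 M) (n + 2)} (hg : IsNewform0 g) : Nonempty (PeriodSymbolDatum g) := by
  classical
  obtain ⟨Ωp, Ωm, -, hΩm, hcoord⟩ := hg.exists_re_im_mem_span_cuspidalLatticeK hn hn0
  obtain ⟨Msub, -, hMR, hM⟩ := hg.exists_fg_rayMoment_rat_mem hn hn0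
  have key : ∀ r : ℚ, IsCoprime (r.den : ℤ) (M : ℤ) →
      ∃ q : coeffField g, ((((rayMoment ⇑g 0 (r : ℝ)).im : ℝ)) : ℂ) = (q : ℂ) * Ωm := by
    intro r hr
    obtain ⟨q, hq, hqe⟩ := (hcoord _ (hMR _ (hM r hr 0 (Nat.zero_le n)))).2
    exact ⟨⟨q, hq⟩, hqe⟩
  refine ⟨⟨Ωm, hΩm, fun r => if hr : IsCoprime (r.den : ℤ) (M : ℤ) then (key r hr).choose else 0,
    fun r hr => ?_⟩⟩
  simp only [dif_pos hr]
  exact (key r hr).choose_spec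

end Existence

/-! ### The predicate -/

section Predicate

variable {M : ℕ} {k : ℤ}

/-- **The twisted symbol sum** `∑_{a mod m} χ(a) · ι([a/m]_g) ∈ ℂ_p` of a period–symbol datum, for a
Dirichlet character `χ` mod `m` with values in `ℂ_p` and an embedding `ι : K_g → ℚ̄_p ⊂ ℂ_p` — the
weight-`k` analogue of the tree's `ratTwistedSymbolSum f χ`; for `χ` even and primitive,
`∑_a χ(a)[a/m]_g · Ω = τ(χ) Λ(g ⊗ χ̄, 1)` (Birch–Manin; Mazur–Tate–Teitelbaum §I.8 (8.6)).
[cite: MazurTateTeitelbaum1986Invent, §I.8 (8.6)] -/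
def twistedSymbolSumK {g : CuspForm (Gamma0 M) k} (D : PeriodSymbolDatum g) {p : ℕ} [Fact p.Prime]
    (ι : coeffField g →+* PadicAlgCl p) {m : ℕ} [NeZero m] (χ : DirichletCharacter ℂ_[p] m) :
    ℂ_[p] :=
  ∑ a : ZMod m, χ a * algebraMap (PadicAlgCl p) ℂ_[p] (ι (D.σ ((a.val : ℚ) / m)))

/-- **`IsCycPAdicLFunctionWeightK g D p ι υ L`: `L ∈ ℚ̄_p⟦T⟧` has the interpolation property of
the cyclotomic `p`-adic `L`-function `L_p(g, υ; T)` of the `ι`-ordinary `p`-stabilisation of the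
weight-`k` newform `g` (unit root `υ`), normalised by the period–symbol datum `D`**
(Mazur–Tate–Teitelbaum 1986, §I.14 (14.3) at `s = 1` with trivial tame character; the weight-`2`
case is the tree's `IsPAdicLFunctionOf`):
* `L(0) = (1 − υ⁻¹)(1 − p^{k−2}υ⁻¹) · ι([0]_g)` (`[0]_g Ω = Λ(g,1)`; `k − 2` as a natural number), and
* for every `m ≥ 1` and every primitive Dirichlet character `χ` of conductor `p^m` with values in
  `ℂ_p` which is a character of `Γ` (even, of `p`-power order), `∑_i c_i (χ(γ) − 1)^i` converges in
  `ℂ_p` to `υ^{−m} ∑_{a mod p^m} χ(a) ι([a/p^m]_g)`, `γ = cyclotomicGenerator p`.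
A `Prop`-valued predicate; nothing asserted. Its `λ`-invariant `normLam L` is Emerton–Pollack–
Weston's `λ^an(g)` (scale-invariant, so independent of `D`).
[cite: MazurTateTeitelbaum1986Invent, §I.14 (14.3)] -/
def IsCycPAdicLFunctionWeightK (g : CuspForm (Gamma0 M) k) (D : PeriodSymbolDatum g) (p : ℕ)
    [Fact p.Prime] (ι : coeffField g →+* PadicAlgCl p) (υ : PadicAlgCl p)
    (L : PowerSeries (PadicAlgCl p)) : Prop :=
  PowerSeries.constantCoeff L =
      (1 - υ⁻¹) * (1 - (p : PadicAlgCl p) ^ (k - 2).toNat * υ⁻¹) * ι (D.σ 0) ∧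
    ∀ (m : ℕ), 0 < m → ∀ χ : DirichletCharacter ℂ_[p] (p ^ m), χ.IsPrimitive → χ.Even →
      (∃ j : ℕ, orderOf χ = p ^ j) →
        HasSum (fun i : ℕ ↦ algebraMap (PadicAlgCl p) ℂ_[p] (PowerSeries.coeff i L) *
            (χ (cyclotomicGenerator p : ZMod (p ^ m)) - 1) ^ i)
          (algebraMap (PadicAlgCl p) ℂ_[p] (υ⁻¹ ^ m) * twistedSymbolSumK D ι χ)

end Predicate

/-! ### Existence (Mazur–Tate–Teitelbaum; Višik; Amice–Vélu) — named fact -/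

section Fact

/-- **Existence of the cyclotomic `p`-adic `L`-function of an ordinary newform of weight `k ≥ 2`
with coefficients in `ℚ̄_p`** (Mazur–Tate–Teitelbaum 1986, §I.10–I.14: for a `p`-stabilised
eigenform with unit `U_p`-eigenvalue the modular-symbol distribution is a bounded measure (§I.11)
and its Mellin transform has the interpolation property (14.3); Višik 1976 / Amice–Vélu 1975 for
general slope). STATEMENT: let `g ∈ S_k(Γ₀(M))` be a newform, `k ≥ 2`, `p ∤ M` prime,
`ι : K_g → ℚ̄_p` a ring embedding, `υ ∈ ℚ̄_p` with `υ² − ι(a_p(g))υ + p^{k−1} = 0` and `|υ|_p = 1`,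
and `D` a period–symbol datum for `g`; then there is `L ∈ ℚ̄_p⟦T⟧` with
`IsCycPAdicLFunctionWeightK g D p ι υ L`, with bounded coefficients all lying in a finite extension
of `ℚ_p` inside `ℚ̄_p` (namely `ℚ_p(ι K_g, υ)`). The tree PROVES the special case in which `ι`
takes values in `ℚ_p`, at the characters `⟨x⟩ʲ` (`exists_mtt_powerSeries_weightK`), and the
weight-`2` rational case in full (`isPAdicLFunctionOf_padicLFunction_of`); the general case is
vendored here as a named fact (`def … : Prop`, nothing asserted; no `_holds`).
-- TODO(general form): arbitrary tame character / nebentypus, all critical twists `j ≤ k − 2`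
-- and odd characters (the `Ω⁻` period), non-ordinary slope `< k − 1` (Višik, Amice–Vélu).
[cite: MazurTateTeitelbaum1986Invent, §I.11 and §I.14 (14.3)] -/
def exists_isCycPAdicLFunctionWeightK : Prop :=
  ∀ {M : ℕ} [NeZero M] {k : ℤ} (g : CuspForm (Gamma0 M) k), IsNewform0 g → 2 ≤ k →
    ∀ (p : ℕ) [Fact p.Prime], ¬ p ∣ M →
    ∀ (ι : coeffField g →+* PadicAlgCl p) (υ : PadicAlgCl p),
      υ ^ 2 - ι ⟨(qExpansion 1 ⇑g).coeff p, coeff_mem_coeffField g p⟩ * υ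
          + (p : PadicAlgCl p) ^ (k - 1).toNat = 0 →
      ‖υ‖ = 1 →
    ∀ (D : PeriodSymbolDatum g),
      ∃ L : PowerSeries (PadicAlgCl p), IsCycPAdicLFunctionWeightK g D p ι υ L ∧
        (∃ C : ℝ, ∀ i, ‖PowerSeries.coeff i L‖ ≤ C) ∧
        ∃ K : IntermediateField ℚ_[p] (PadicAlgCl p), FiniteDimensional ℚ_[p] K ∧
          ∀ i, PowerSeries.coeff i L ∈ K

end Fact

end Literature.NumberTheory.EllipticCurves.ModularForms

end
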